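import Summits.QuantumFields.BalabanUV.Beta.EriceRemainderEnclosureHistoryAutonomyComparisonAgeCompositionSeparatedAges
import Summits.QuantumFields.BalabanUV.Beta.EriceRemainderEnclosureHistoryAutonomyComparisonAgeCompositionClusterCascadeYoungest

/-!
# EriceRemainderEnclosureHistoryAutonomyComparisonAgeCompositionClusterLevelsYoungest — (E99e) route (N), first order: THE CLUSTER CASCADE WITH A SHARP
# LAST STEP ALONG FLOWS, LEVEL CAPS AS HYPOTHESES.  The twin of (E99c) `…ClusterLevels` for the engine (E96a) `renewal_nonneg_cluster_cascade_youngest`: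
# levels are ARBITRARY finite clusters `S j ⊂ [1, K)` (`j < r`), pairwise disjoint, carrying the profile, members `lo j ≤ k ≤ hi j`, MASS CAPS
# `Σ_{k∈S 0} x_k(q) ≤ s₀` and `Σ_{k∈S j} x_k(q) ≤ s` (`j ≥ 1`) as HYPOTHESES, separation `R₀·hi j ≤ lo (j+1)` for `j ≥ 1` and a SEPARATE youngest gap
# `ρ₀·hi 0 ≤ lo 1` with its own closure `s₀(ρ₀λ + 4s(1+κ) + κ) ≤ ρ₀λ` (`λ = 1 − s(1+κ)`) in place of `s₀(1+κ) ≤ 1` — the form that lets a young age of cap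
# `0.7072` sit at ratio `30` below a ×61 chain ((E96b)); weights, masses, rates and the summed relative variation of the clusters exactly as in (E99c).
# The sequel (E99f) `…NearPairSeparatedAgesEvery` puts near old pairs ((E99b), cap `0.617`) in the chain and closes the census four ages
# `{1, k₂, k₃, k₄}`, `61k₂ ≤ k₃ < k₄ ≤ 2k₃`, at EVERY `k₂ ≥ 2`
Cell `pub-balaban`, β-function sub-cell, BINDER row D4 «RemainderConst leaves for Bałaban's split» (`HOME/BINDER-OWNERS.md`; owner lineage `b2b-balaban-beta-an4`;
this file by co-owner #2 lineage `b2b-balaban-beta-d4-p2`, generation 87), β-FLOW TEAM duty (1), FREEZE (0) honoured (def-free; nothing restated).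

HONEST FRAMING (page 1, verbatim and binding).  *"Discharging BetaPertH makes Bałaban's UV stability UNCONDITIONAL — a real constructive-QFT result; it is
NOT the continuum limit and NOT the Clay problem."*  THIS FILE DISCHARGES NOTHING OF THE KIND.  Elementary real algebra ∕ real analysis about ABSTRACT
functionals on a box ]0,γ]^ℕ with displayed floors, profiles and signs, and the FIRST-ORDER renewal objects of route (N) built from them — hypotheses of a
census, not facts; the form, signs, ages and moments of Bałaban's (1.22) limit functional are NOT PRINTED ([I] p. 298; GAPS G-t4-U2-1∕-2) and NOT asserted.
Row D4 class UNCHANGED (critical-path width 0; instance 0∕1; D4 DISCHARGE NO DATE).  HONEST DEPENDENCY: continuum YM on T⁴ ⇐ BetaPertH ∧ nine spine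
estimates (0/9 proved); BetaPertH ⇐ (D1) ∧ (D4) ∧ CAP+tail; G-an2-4 gates asym, D1 and NE2/3/4.

THE POINT (README `HOME/b2b-balaban-beta-d4-p2/g87/README.md` §3).  As (E99c): what the engine uses of a level is only (`hi`, `lo`, mass, rate); for
a cluster of ages every one of these is the SUM over its members of the single-age object, and the single-age facts ((E82a) `kernel_entry_le`∕`row_mass_le`,
(E95b) `old_read_variation_of_bound`) add up.  The aggregate row is the sum over the clusters ((E80b) `aggregate_eq_sum`, (E95b) `kernel_zero_of_profile_zero`,
`Finset.sum_biUnion`).  Uses (E96a) `renewal_nonneg_cluster_cascade_youngest` BY NAME.  NOT CLAIMED: any cap (they are hypotheses here); anything printed — NOT B12 Thm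
2, NOT BetaPertH, NOT continuum, NOT Clay.

WHAT IS PROVED ([folklore]; 0 `def`, 0 sorry).  **`flow_nonneg_cluster_levels_of_caps_youngest`**.
-/
noncomputable section
open Finset

namespace Summit.QuantumFields.BalabanUV.Beta.EriceRemainderEnclosureHistoryAutonomyComparisonAgeCompositionClusterLevelsYoungest

open Literature.MathematicalPhysics.QuantumFieldTheory.Balaban1983to89
open Literature.MathematicalPhysics.QuantumFieldTheory.Balaban1983to89.T4BetaStationary
open Literature.MathematicalPhysics.QuantumFieldTheory.Balaban1983to89.T4BetaFlowWellPosed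
open Summit.QuantumFields.BalabanUV.Beta.EriceRemainderEnclosureHistoryAutonomyComparisonAgeCompositionYoungestTailSumFlow (kernel_entry_le row_mass_le)
open Summit.QuantumFields.BalabanUV.Beta.EriceRemainderEnclosureHistoryAutonomyComparisonAgeCompositionChainWiring (aggregate_eq_sum)
open Summit.QuantumFields.BalabanUV.Beta.EriceRemainderEnclosureHistoryAutonomyComparisonAgeCompositionSeparatedAges
  (old_read_variation_of_bound kernel_zero_of_profile_zero)
open Summit.QuantumFields.BalabanUV.Beta.EriceRemainderEnclosureHistoryAutonomyComparisonAgeCompositionClusterCascadeYoungest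
  (renewal_nonneg_cluster_cascade_youngest)

variable {B : (ℕ → ℝ) → ℝ} {γ b gIR : ℝ} {L : ℕ → ℝ} {K : ℕ} {h g : ℕ → ℝ}

/-- **THE CLUSTER CASCADE WITH A SHARP LAST STEP ALONG FLOWS, CAPS AS HYPOTHESES.**  As (E99c) `flow_nonneg_cluster_levels_of_caps` (isotone dominated
memory with floor, box solution, self-consistent damping, route-(N) renewal objects; clusters `S j`, `j < r`, pairwise disjoint, members `1 ≤ k < K` with
`lo j ≤ k ≤ hi j`, `lo j ≤ hi j` for `j ≥ 1`, profile vanishing off the clusters; caps `Σ_{k∈S 0} x_k ≤ s₀`, `Σ_{k∈S j} x_k ≤ s` for `j ≥ 1`) but with the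
separations `ρ₀·hi 0 ≤ lo 1` (youngest gap) and `R₀·hi j ≤ lo (j+1)` (`j ≥ 1`) and the closures `κ > 0`, `s ≥ 0`, `s(1+κ) < 1`,
`κ + 4s(1+κ) ≤ R₀(1 − s(1+κ))κ`, `ρ₀ ≥ 1`, `s₀(ρ₀(1 − s(1+κ)) + 4s(1+κ) + κ) ≤ ρ₀(1 − s(1+κ))`.  THEN `0 ≤ ε ≤ e` at every pin ((E96a)
`renewal_nonneg_cluster_cascade_youngest`). [folklore] -/
theorem flow_nonneg_cluster_levels_of_caps_youngest
    (hmono : ∀ u v : ℕ → ℝ, SeqBox γ u → SeqBox γ v → (∀ j, u j ≤ v j) → B u ≤ B v)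
    (hL : ∀ k, 0 ≤ L k) (hb : 0 < b) (hlo : ∀ u, SeqBox γ u → b ≤ B u) (hdom : ∀ u, SeqBox γ u → ∑ k ∈ range K, L k * u k ≤ B u)
    (hh : SeqBox γ h) (hf : MemFlow B gIR h) (hg : ∀ t, 0 < g t ∧ g t ≤ 1)
    (hgF : ∀ t, 1 ≤ g t * (1 + ∑ k ∈ range K, L k * h (t + k) ^ 3 / 2)) (hK : 1 ≤ K)
    {κ s₀ s : ℝ} {R₀ ρ₀ : ℕ} (hκ : 0 < κ) (hs : 0 ≤ s) (hsC : s * (1 + κ) < 1)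
    (hR : κ + 4 * s * (1 + κ) ≤ (R₀ : ℝ) * (1 - s * (1 + κ)) * κ)
    (hρ₀ : 1 ≤ ρ₀) (hyoung : s₀ * ((ρ₀ : ℝ) * (1 - s * (1 + κ)) + (4 * s * (1 + κ) + κ)) ≤ (ρ₀ : ℝ) * (1 - s * (1 + κ)))
    {r : ℕ} {S : ℕ → Finset ℕ} {lo hi : ℕ → ℕ}
    (hSK : ∀ j, j < r → ∀ k ∈ S j, 1 ≤ k ∧ k < K) (hSlo : ∀ j, j < r → ∀ k ∈ S j, lo j ≤ k)
    (hShi : ∀ j, j < r → ∀ k ∈ S j, k ≤ hi j) (hlohi : ∀ j, 1 ≤ j → j < r → lo j ≤ hi j)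
    (hsep0 : 1 < r → ρ₀ * hi 0 ≤ lo 1) (hsep : ∀ j, 1 ≤ j → j + 1 < r → R₀ * hi j ≤ lo (j + 1))
    (hdisj : ∀ i j, i < j → j < r → Disjoint (S i) (S j))
    (hLS : ∀ l, l < K → (∀ j, j < r → l ∉ S j) → L l = 0)
    (hcap0 : ∀ q, ∑ k ∈ S 0, (k : ℝ) * (L k * h (q + k) ^ 3 / 2) ≤ s₀)
    (hcap : ∀ j q, 1 ≤ j → j < r → ∑ k ∈ S j, (k : ℝ) * (L k * h (q + k) ^ 3 / 2) ≤ s)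
    {N : ℕ} {KL : ℕ → ℕ → ℕ → ℝ}
    (hKL : ∀ k n l, KL k n l = if 0 < k ∧ k < K ∧ l < k then L k * h (n + k) ^ 3 / 2 * ∏ t ∈ Ico (n + 1 + l) (n + k + 1), g t else 0)
    {KA : ℕ → ℕ → ℕ → ℝ} {RA : ℕ → (ℕ → ℝ) → ℕ → ℝ}
    (hRA : ∀ i v m, RA i v m = ∑ l ∈ range K, KA i m l * v (m + 1 + l))
    (hKA : ∀ i m l, KA i m l = KL i m l + KA (i + 1) m l) (hKAtop : ∀ m l, KA K m l = 0)
    {e ε : ℕ → ℝ} (he0 : ∀ m, 0 ≤ e m) (hea : ∀ m, e (m + 1) ≤ e m)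
    (hεt : ∀ m, N < m → ε m = 0) (hεrec : ∀ m, ε m = e m - RA 1 ε m) : ∀ m, 0 ≤ ε m ∧ ε m ≤ e m := by
  have hpos : ∀ n, 0 < h n := fun n => (hh n).1
  have hc0 : ∀ k q, 0 ≤ L k * h (q + k) ^ 3 / 2 := fun k q => by have := hL k; have := hpos (q + k); positivity
  have hL0 : L 0 = 0 := hLS 0 (by omega) fun j hj h0 => by have := (hSK j hj 0 h0).1; omega
  -- the levels, guarded beyond r
  obtain ⟨S', hS'⟩ : ∃ S' : ℕ → Finset ℕ, ∀ j, S' j = if j < r then S j else ∅ := ⟨_, fun _ => rfl⟩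
  have hS'r : ∀ j, j < r → S' j = S j := fun j hj => by rw [hS', if_pos hj]
  have hS'K : ∀ j, ∀ k ∈ S' j, 1 ≤ k ∧ k < K ∧ lo j ≤ k ∧ k ≤ hi j ∧ j < r := by
    intro j k hk
    by_cases hj : j < r
    · rw [hS'r j hj] at hk
      exact ⟨(hSK j hj k hk).1, (hSK j hj k hk).2, hSlo j hj k hk, hShi j hj k hk, hj⟩
    · rw [hS', if_neg hj] at hk
      exact absurd hk (by simp)
  -- THE AGGREGATE ROW IS THE SUM OVER THE CLUSTERS
  have hagg : ∀ q l, KA 1 q l = ∑ j ∈ range r, ∑ k ∈ S j, KL k q l := by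
    intro q l
    have h1 : KA 1 q l = ∑ k ∈ Ico 1 (K - 1 + 1), KL k q l :=
      aggregate_eq_sum (n := K - 1) hKA (fun m l => by rw [Nat.sub_add_cancel hK]; exact hKAtop m l) (show 1 ≤ K - 1 + 1 by omega) q l
    rw [h1, Nat.sub_add_cancel hK]
    have hsub : (range r).biUnion S ⊆ Ico 1 K := by
      intro x hx
      obtain ⟨j, hj, hxj⟩ := mem_biUnion.mp hx
      have := hSK j (mem_range.mp hj) x hxj
      rw [mem_Ico]; omega
    have hpd : Set.PairwiseDisjoint (↑(range r) : Set ℕ) S := by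
      intro i hi j hj hij
      rcases Nat.lt_or_gt_of_ne hij with hlt | hlt
      · exact hdisj i j hlt (mem_range.mp (Finset.mem_coe.mp hj))
      · exact (hdisj j i hlt (mem_range.mp (Finset.mem_coe.mp hi))).symm
    rw [← sum_subset hsub (fun x hx hxn => ?_), sum_biUnion hpd]
    exact kernel_zero_of_profile_zero hKL
      (hLS x (mem_Ico.mp hx).2 fun j hj hxj => hxn (mem_biUnion.mpr ⟨j, mem_range.mpr hj, hxj⟩)) q l
  -- the level data: weights, masses, rates, reads
  obtain ⟨w, hw⟩ : ∃ w : ℕ → ℕ → ℕ → ℝ, ∀ j q l, w j q l = ∑ k ∈ S' j, KL k q l := ⟨_, fun _ _ _ => rfl⟩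
  obtain ⟨x, hx⟩ : ∃ x : ℕ → ℕ → ℝ, ∀ j q, x j q = ∑ k ∈ S' j, (k : ℝ) * (L k * h (q + k) ^ 3 / 2) := ⟨_, fun _ _ => rfl⟩
  obtain ⟨ν, hν⟩ : ∃ ν : ℕ → ℕ → ℝ, ∀ j q, ν j q = ∑ k ∈ S' j, 4 * (L k * h (q + k) ^ 3 / 2) := ⟨_, fun _ _ => rfl⟩
  obtain ⟨O, hO⟩ : ∃ O : ℕ → ℕ → ℝ, ∀ j q, O j q = ∑ l ∈ range K, w j q l * ε (q + 1 + l) := ⟨_, fun _ _ => rfl⟩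
  -- the recursion with the level reads displayed
  have hrec : ∀ q, ε q = e q - ∑ j ∈ range r, O j q := by
    intro q
    rw [hεrec q, hRA]
    have h1 : ∑ j ∈ range r, O j q = ∑ l ∈ range K, (∑ j ∈ range r, w j q l) * ε (q + 1 + l) := by
      simp_rw [hO, sum_mul]; rw [sum_comm]
    have h2 : ∀ l, ∑ j ∈ range r, w j q l = KA 1 q l := by
      intro l
      rw [hagg]
      exact sum_congr rfl fun j hj => by rw [hw, hS'r j (mem_range.mp hj)]
    rw [h1]
    simp_rw [h2]
  -- no level at all: ε = e
  rcases Nat.eq_zero_or_pos r with hr0 | hrpos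
  · intro m; rw [hrec m, hr0, sum_range_zero, sub_zero]; exact ⟨he0 m, le_rfl⟩
  -- the reads of a level, member by member
  have hOk : ∀ j q, O j q = ∑ k ∈ S' j, ∑ l ∈ range K, KL k q l * ε (q + 1 + l) := by
    intro j q; rw [hO]; simp_rw [hw, sum_mul]; rw [sum_comm]
  refine renewal_nonneg_cluster_cascade_youngest (r := r) (N := N) (Kw := K) (R₀ := R₀) (ρ₀ := ρ₀) (κ := κ) (s₀ := s₀) (s := s) (lo := lo)
    (hi := hi) (w := w) (x := x) (ν := ν) (O := O) (e := e) (ε := ε) hκ hs hsC hR hρ₀ hyoung hsep0 hsep hlohi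
    (fun j q l => ?_) (fun j q l hl => ?_) (fun j q => ?_) (fun j q => ?_) (fun j q _ => ?_) (fun q => ?_) (fun j q hj1 hjr => ?_)
    (fun j q _ _ => ?_) hO (fun j m d T _ _ hd1 hdj hT hnn hle => ?_) he0 hea hεt hrec
  · -- weights are non-negative
    rw [hw]; exact sum_nonneg fun k _ => (kernel_entry_le hL hh hg hKL k q l).1
  · -- weights vanish beyond the window hi j
    rw [hw]
    refine sum_eq_zero fun k hk => ?_
    have := (hS'K j k hk).2.2.2.1
    rw [hKL, if_neg (by omega)]
  · -- masses are non-negative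
    rw [hx]; exact sum_nonneg fun k _ => mul_nonneg (Nat.cast_nonneg _) (hc0 k q)
  · -- rates are non-negative
    rw [hν]; exact sum_nonneg fun k _ => by have := hc0 k q; positivity
  · -- row sums ≤ mass
    simp_rw [hw, hx]
    rw [sum_comm]
    exact sum_le_sum fun k hk => row_mass_le hL hh hg hKL (hS'K j k hk).2.1 q
  · -- the youngest cap
    rw [hx, hS'r 0 hrpos]; exact hcap0 q
  · -- the older caps
    rw [hx, hS'r j hjr]; exact hcap j q hj1 hjr
  · -- lo·ν ≤ 4x
    rw [hx, hν, mul_sum, mul_sum]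
    refine sum_le_sum fun k hk => ?_
    have hlok : (lo j : ℝ) ≤ k := by exact_mod_cast (hS'K j k hk).2.2.1
    have := hc0 k q
    nlinarith
  · -- the relative variation of the level's read: member by member, (E95b)
    rw [hOk, hOk, ← sum_sub_distrib, hν, sum_mul, sum_mul]
    refine sum_le_sum fun k hk => ?_
    obtain ⟨hk1, hkK, hlok, hkhi, -⟩ := hS'K j k hk
    have hv := old_read_variation_of_bound hmono hL hb hlo hdom hh hf hL0 hg hgF hKL (by omega) hkK hd1 (le_trans hdj hlok) hT hnn
      (fun q hq hqk => hle q hq (by omega))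
    have e1 : 4 * (d : ℝ) * (L k * h (m + k) ^ 3 / 2) * T = 4 * (L k * h (m + k) ^ 3 / 2) * d * T := by ring
    rw [e1] at hv
    exact hv

end Summit.QuantumFields.BalabanUV.Beta.EriceRemainderEnclosureHistoryAutonomyComparisonAgeCompositionClusterLevelsYoungest
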